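import Mathlib
import HarnessLib
import Summits.QuantumAdvantage.QuantumAdvantage.Theorems.SoloInformedGrothendieckFrobenius

/-!
# THEOREM H (problem-side half): deleting `O(1/o)` coordinates brings the `{1}{2,3}` flattening of a
# trilinear form below `o`, given a ROW-WEIGHT Grothendieck factorization

Solo seat `solo-QuantumAdvantage-informed`, session 14, file 33 (§4.29 (4)–(5) of the seat's paper).

For a real trilinear form `T` on `ℝⁿ × ℝⁿ × ℝⁿ` the `{1}{2,3}` flattening norm is
`sup {⟨T, x ⊗ Y⟩ : ‖x‖₂ ≤ 1, ‖Y‖_F ≤ 1}`, `⟨T, x ⊗ Y⟩ = Σ_{ijk} T_{ijk} x_i Y_{jk}` (written out as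
the triple sum `∑ i, ∑ j, ∑ k, T i j k * x i * Y j k` throughout; no new definitions). THEOREM R of the paper
(Grothendieck's theorem for the pair `(ℓ_∞, ℓ₁(ℓ₂))`, proved there from the commutative GT + little GT via a
Khintchine embedding, or read off Haagerup's non-commutative Grothendieck inequality) supplies probability
weights `w, W` on `[n]` with the ROW-WEIGHT factorization

  `|⟨T, x ⊗ Y⟩| ≤ K · (Σ_i w_i x_i²)^{1/2} · (Σ_j W_j Σ_k Y_{jk}²)^{1/2}`   for all real `x`, `Y`,

`K ≤ √π·K_G²·sup_{cube}|T|`. This file kernel-checks what follows from ANY such factorization (the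
factorization is the hypothesis `hfac`, exactly as files 29–30 treat the degree-2 Grothendieck
factorization):

* `rowweight_deletion` — for `τ > 0` the set `F = {w > τ} ∪ {W > τ}` has `|F|·τ ≤ 2` and
  `|⟨T, x ⊗ Y⟩| ≤ K·τ·‖x‖₂·‖Y‖_F` whenever `x` vanishes on `F` and the rows `j ∈ F` of `Y` vanish;
* `rowweight_deletion_number_le` — THEOREM H: `N^{{1}{2,3}}_del(T, o) ≤ 2K/o` (`|F| ≤ 2K/o`, bound
  `o·‖x‖₂·‖Y‖_F` off `F`);
* `injective_deletion_number_le` — COROLLARY H′: the same `F` gives `|T(x,y,z)| ≤ o‖x‖₂‖y‖₂‖z‖₂` for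
  `x, y` vanishing on `F` and arbitrary real `z` (injective norm `≤` flattening norm), so
  `N^{inj}_del(T, η) ≤ 2K/η`.

Both rates are tight (3-dimensional matching, §4.29 (5)). No hypothesis on `T` (symmetry, cube bounds)
is needed in this half; they enter only through the constant `K` of the factorization.
-/

namespace Summit.QuantumAdvantage.QuantumAdvantage.Theorems

namespace BoundedCubic

open Finset

variable {n : ℕ}

/-- Markov count: the coordinates of weight `> τ` of a sub-probability weight satisfy `#·τ ≤ 1`
(for any real `τ`; informative for `τ > 0`). -/
lemma card_filter_mul_le (w : Fin n → ℝ) (hw : ∀ i, 0 ≤ w i) (hw1 : ∑ i, w i ≤ 1) (τ : ℝ) :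
    ((univ.filter fun i => τ < w i).card : ℝ) * τ ≤ 1 := by
  have h1 : ((univ.filter fun i => τ < w i).card : ℝ) * τ
      = ∑ i ∈ univ.filter (fun i => τ < w i), τ := by rw [sum_const, nsmul_eq_mul]
  rw [h1]
  calc ∑ i ∈ univ.filter (fun i => τ < w i), τ
      ≤ ∑ i ∈ univ.filter (fun i => τ < w i), w i :=
        sum_le_sum fun i hi => le_of_lt (mem_filter.mp hi).2
    _ ≤ ∑ i, w i := sum_le_sum_of_subset_of_nonneg (filter_subset _ _) fun i _ _ => hw i
    _ ≤ 1 := hw1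

/-- Weighted mass off the heavy set: if `x` vanishes where `w > τ` then `Σ wᵢxᵢ² ≤ τ Σ xᵢ²`. -/
lemma weighted_mass_le (w : Fin n → ℝ) {τ : ℝ} (x : Fin n → ℝ)
    (hx : ∀ i, τ < w i → x i = 0) : ∑ i, w i * x i ^ 2 ≤ τ * ∑ i, x i ^ 2 := by
  rw [mul_sum]
  refine sum_le_sum fun i _ => ?_
  by_cases hi : τ < w i
  · simp [hx i hi]
  · exact mul_le_mul_of_nonneg_right (not_lt.mp hi) (sq_nonneg _)

/-- **Deletion from a row-weight factorization.** If
`|⟨T, x⊗Y⟩| ≤ K (Σ wᵢxᵢ²)^{1/2} (Σ_j W_j Σ_k Y_{jk}²)^{1/2}` for all real `x, Y`, with sub-probability weights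
`w, W`, then `F = {w > τ} ∪ {W > τ}` has `|F|·τ ≤ 2` and `|⟨T, x⊗Y⟩| ≤ K·τ·‖x‖₂·‖Y‖_F` for all `x`
vanishing on `F` and all `Y` whose rows `j ∈ F` vanish. -/
theorem rowweight_deletion (T : Fin n → Fin n → Fin n → ℝ) {K τ : ℝ} (hK : 0 ≤ K) (hτ : 0 < τ)
    (w W : Fin n → ℝ) (hw : ∀ i, 0 ≤ w i) (hw1 : ∑ i, w i ≤ 1) (hW : ∀ j, 0 ≤ W j)
    (hW1 : ∑ j, W j ≤ 1)
    (hfac : ∀ (x : Fin n → ℝ) (Y : Fin n → Fin n → ℝ), |∑ i, ∑ j, ∑ k, T i j k * x i * Y j k| ≤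
      K * Real.sqrt (∑ i, w i * x i ^ 2) * Real.sqrt (∑ j, W j * ∑ k, Y j k ^ 2)) :
    ∃ F : Finset (Fin n), (F.card : ℝ) * τ ≤ 2 ∧
      ∀ (x : Fin n → ℝ) (Y : Fin n → Fin n → ℝ), (∀ i ∈ F, x i = 0) → (∀ j ∈ F, ∀ k, Y j k = 0) →
        |∑ i, ∑ j, ∑ k, T i j k * x i * Y j k| ≤ K * τ * Real.sqrt (∑ i, x i ^ 2) * Real.sqrt (∑ j, ∑ k, Y j k ^ 2) := by
  classical
  set F₁ := univ.filter fun i => τ < w i with hF₁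
  set F₂ := univ.filter fun j => τ < W j with hF₂
  refine ⟨F₁ ∪ F₂, ?_, ?_⟩
  · have h1 := card_filter_mul_le w hw hw1 τ
    have h2 := card_filter_mul_le W hW hW1 τ
    have hc : ((F₁ ∪ F₂).card : ℝ) ≤ (F₁.card : ℝ) + (F₂.card : ℝ) := by
      exact_mod_cast card_union_le F₁ F₂
    nlinarith
  · intro x Y hx hY
    -- masses off the heavy sets
    have mx : ∑ i, w i * x i ^ 2 ≤ τ * ∑ i, x i ^ 2 :=
      weighted_mass_le w x fun i hi => hx i (mem_union_left _ (mem_filter.mpr ⟨mem_univ _, hi⟩))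
    have mY : ∑ j, W j * ∑ k, Y j k ^ 2 ≤ τ * ∑ j, ∑ k, Y j k ^ 2 := by
      rw [mul_sum]
      refine sum_le_sum fun j _ => ?_
      by_cases hj : τ < W j
      · have h0 : ∀ k, Y j k = 0 :=
          hY j (mem_union_right _ (mem_filter.mpr ⟨mem_univ _, hj⟩))
        simp [h0]
      · exact mul_le_mul_of_nonneg_right (not_lt.mp hj) (sum_nonneg fun k _ => sq_nonneg _)
    have rx : Real.sqrt (∑ i, w i * x i ^ 2) ≤ Real.sqrt τ * Real.sqrt (∑ i, x i ^ 2) := by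
      rw [← Real.sqrt_mul hτ.le]; exact Real.sqrt_le_sqrt mx
    have rY : Real.sqrt (∑ j, W j * ∑ k, Y j k ^ 2) ≤
        Real.sqrt τ * Real.sqrt (∑ j, ∑ k, Y j k ^ 2) := by
      rw [← Real.sqrt_mul hτ.le]; exact Real.sqrt_le_sqrt mY
    have hτ2 : Real.sqrt τ * Real.sqrt τ = τ := Real.mul_self_sqrt hτ.le
    calc |∑ i, ∑ j, ∑ k, T i j k * x i * Y j k|
        ≤ K * Real.sqrt (∑ i, w i * x i ^ 2) * Real.sqrt (∑ j, W j * ∑ k, Y j k ^ 2) := hfac x Y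
      _ ≤ K * (Real.sqrt τ * Real.sqrt (∑ i, x i ^ 2)) *
            Real.sqrt (∑ j, W j * ∑ k, Y j k ^ 2) := by
          apply mul_le_mul_of_nonneg_right _ (Real.sqrt_nonneg _)
          exact mul_le_mul_of_nonneg_left rx hK
      _ ≤ K * (Real.sqrt τ * Real.sqrt (∑ i, x i ^ 2)) *
            (Real.sqrt τ * Real.sqrt (∑ j, ∑ k, Y j k ^ 2)) := by
          apply mul_le_mul_of_nonneg_left rY
          exact mul_nonneg hK (mul_nonneg (Real.sqrt_nonneg _) (Real.sqrt_nonneg _))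
      _ = K * (Real.sqrt τ * Real.sqrt τ) * Real.sqrt (∑ i, x i ^ 2) *
            Real.sqrt (∑ j, ∑ k, Y j k ^ 2) := by ring
      _ = K * τ * Real.sqrt (∑ i, x i ^ 2) * Real.sqrt (∑ j, ∑ k, Y j k ^ 2) := by rw [hτ2]

/-- **THEOREM H (`o`-form).** Under a row-weight factorization with constant `K > 0`, for every `o > 0`
at most `2K/o` coordinates `F` make `|⟨T, x⊗Y⟩| ≤ o‖x‖₂‖Y‖_F` for all `x` vanishing on `F` and `Y` with
rows in `F` vanishing: `N^{{1}{2,3}}_del(T, o) ≤ 2K/o`. -/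
theorem rowweight_deletion_number_le (T : Fin n → Fin n → Fin n → ℝ) {K : ℝ} (hK : 0 < K)
    (w W : Fin n → ℝ) (hw : ∀ i, 0 ≤ w i) (hw1 : ∑ i, w i ≤ 1) (hW : ∀ j, 0 ≤ W j)
    (hW1 : ∑ j, W j ≤ 1)
    (hfac : ∀ (x : Fin n → ℝ) (Y : Fin n → Fin n → ℝ), |∑ i, ∑ j, ∑ k, T i j k * x i * Y j k| ≤
      K * Real.sqrt (∑ i, w i * x i ^ 2) * Real.sqrt (∑ j, W j * ∑ k, Y j k ^ 2))
    {o : ℝ} (ho : 0 < o) :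
    ∃ F : Finset (Fin n), (F.card : ℝ) ≤ 2 * K / o ∧
      ∀ (x : Fin n → ℝ) (Y : Fin n → Fin n → ℝ), (∀ i ∈ F, x i = 0) → (∀ j ∈ F, ∀ k, Y j k = 0) →
        |∑ i, ∑ j, ∑ k, T i j k * x i * Y j k| ≤ o * Real.sqrt (∑ i, x i ^ 2) * Real.sqrt (∑ j, ∑ k, Y j k ^ 2) := by
  obtain ⟨F, hcard, hF⟩ := rowweight_deletion T hK.le (div_pos ho hK) w W hw hw1 hW hW1 hfac
  have hKo : K * (o / K) = o := by field_simp
  refine ⟨F, ?_, fun x Y hx hY => ?_⟩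
  · rw [le_div_iff₀ ho]
    calc (F.card : ℝ) * o = (F.card : ℝ) * (o / K) * K := by
          rw [mul_assoc, div_mul_cancel₀ o hK.ne']
      _ ≤ 2 * K := mul_le_mul_of_nonneg_right hcard hK.le
  · have h := hF x Y hx hY
    rw [hKo] at h
    exact h

/-- **COROLLARY H′ (injective norm).** The same `F` bounds the trilinear form on unit vectors:
`|T(x,y,z)| ≤ o‖x‖₂‖y‖₂‖z‖₂` whenever `x` and `y` vanish on `F` (`z` arbitrary), so
`N^{inj}_del(T, η) ≤ 2K/η`. -/
theorem injective_deletion_number_le (T : Fin n → Fin n → Fin n → ℝ) {K : ℝ} (hK : 0 < K)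
    (w W : Fin n → ℝ) (hw : ∀ i, 0 ≤ w i) (hw1 : ∑ i, w i ≤ 1) (hW : ∀ j, 0 ≤ W j)
    (hW1 : ∑ j, W j ≤ 1)
    (hfac : ∀ (x : Fin n → ℝ) (Y : Fin n → Fin n → ℝ), |∑ i, ∑ j, ∑ k, T i j k * x i * Y j k| ≤
      K * Real.sqrt (∑ i, w i * x i ^ 2) * Real.sqrt (∑ j, W j * ∑ k, Y j k ^ 2))
    {o : ℝ} (ho : 0 < o) :
    ∃ F : Finset (Fin n), (F.card : ℝ) ≤ 2 * K / o ∧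
      ∀ x y z : Fin n → ℝ, (∀ i ∈ F, x i = 0) → (∀ j ∈ F, y j = 0) →
        |∑ i, ∑ j, ∑ k, T i j k * x i * y j * z k| ≤
          o * Real.sqrt (∑ i, x i ^ 2) * Real.sqrt (∑ j, y j ^ 2) * Real.sqrt (∑ k, z k ^ 2) := by
  obtain ⟨F, hcard, hF⟩ := rowweight_deletion_number_le T hK w W hw hw1 hW hW1 hfac ho
  refine ⟨F, hcard, fun x y z hx hy => ?_⟩
  have hY : ∀ j ∈ F, ∀ k, Matrix.vecMulVec y z j k = 0 := fun j hj k => by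
    simp [Matrix.vecMulVec_apply, hy j hj]
  have h := hF x (Matrix.vecMulVec y z) hx hY
  simp only [Matrix.vecMulVec_apply] at h
  have hform : ∑ i, ∑ j, ∑ k, T i j k * x i * (y j * z k)
      = ∑ i, ∑ j, ∑ k, T i j k * x i * y j * z k :=
    sum_congr rfl fun i _ => sum_congr rfl fun j _ => sum_congr rfl fun k _ => by ring
  have hprod : ∑ j, ∑ k, (y j * z k) ^ 2 = (∑ j, y j ^ 2) * ∑ k, z k ^ 2 := by
    rw [sum_mul_sum]
    exact sum_congr rfl fun j _ => sum_congr rfl fun k _ => by ring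
  rw [hform, hprod, Real.sqrt_mul (sum_nonneg fun j _ => sq_nonneg (y j))] at h
  calc |∑ i, ∑ j, ∑ k, T i j k * x i * y j * z k|
      ≤ o * Real.sqrt (∑ i, x i ^ 2) * (Real.sqrt (∑ j, y j ^ 2) * Real.sqrt (∑ k, z k ^ 2)) := h
    _ = o * Real.sqrt (∑ i, x i ^ 2) * Real.sqrt (∑ j, y j ^ 2) * Real.sqrt (∑ k, z k ^ 2) := by
        ring

end BoundedCubic

end Summit.QuantumAdvantage.QuantumAdvantage.Theorems
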